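import Summits.BirchSwinnertonDyer.BirchSwinnertonDyer.Theorems.ManinLocalTwoThreeDescentTwoIndex
import Summits.BirchSwinnertonDyer.BirchSwinnertonDyer.Theorems.ManinLocalTwoThreeExtensionLemmas
import HarnessLib

/-!
# E-es-37 for `j ≥ 2`, part 2b: the extension across the index-`2` step `Γ₀(2^jL′) ◁ Γ₀(2^{j−1}L′)` and its
# `2`-shift invariance (MEMO-es §25.9 (D))

Summit `BirchSwinnertonDyer`, route `ManinLocalTwoThree` (cell bsd-f2-manin), crux C2 `ManinOddAtFour` (stmt-BirchSwinnertonDyer-22967),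
line `kato_shift_two` v6, stub 3 (`C₃`-image residual), descent step [D] = E-es-37 at `t = 2`, `j ≥ 2`.  Notation: `N = 2^jL′`,
`N′ = 2^{j−1}L′`, `x = 2^{j−1}L′`, `g = U⁻(x) = (1 0; x 1) ∈ Γ₀(N′) ∖ Γ₀(N)`, `u` a `2`-shift-invariant generalised `λ`-eigen
degree-`0` cocycle on `Γ₀(N)` with hNT(2), `L′` odd, `K` of characteristic `p`.

* `index_gamma0_level_two`: `[Γ₀(N′) : Γ₀(N)] = 2` (`Subgroup.index_eq_two_iff` with `a := g`), and the coset dichotomy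
  `mem_or_lowerUnip_inv_mul_mem`;
* `apply_lowerUnip_sq_eq_zero`: `u(g²) = 0` (no cusp hypothesis: `g² = U⁻(N)` is the `2`-shift of `g⁴ ∈ Γ₀(2N)`, so
  `u(g²) = u(g⁴) = 2u(g²)`);
* `exists_descentTwo_extension`: an additive `Ψ : Γ₀(N′) → K` with `Ψ|Γ₀(N) = u` and `Ψ(g) = 0` — es's `extTwo` (p605692) with
  `y := 0`, the `g`-stability being part 1's `adLowerUnip_invariant` (p607202);
* `descentTwo_apply_lowerUnip_eq`: ANY additive `2`-shift-invariant `Ψ′` on `Γ₀(N′)` has `Ψ′(g) = Ψ′(g²)` (`g` is the `2`-shift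
  of `g²`) — the source of uniqueness;
* `descentTwo_shiftInvariant`: such a `Ψ` (additive, `Ψ|Γ₀(N) = u`, `Ψ(g) = 0`) is `2`-shift-invariant on `Γ₀(N′)`: for
  `δ ∈ Γ₀(2N′) = Γ₀(N)` either `4x ∣ c_δ` (then `AδA⁻¹ ∈ Γ₀(N)` and it is `u`'s shift-invariance) or `AδA⁻¹ = g·A δ₂ A⁻¹` with
  `δ₂ = g⁻²δ ∈ Γ₀(2N)`, so `Ψ(AδA⁻¹) = Ψ(g) + u(δ₂) = u(δ)` (§25.9 (D) verbatim).

Part 3 (`…DescentTwo.lean`): Hecke, cusps, uniqueness, and the packaged `∃!`.  No new definitions; nothing about BSD or Manin's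
conjecture is proved here.

References: K. S. Brown, *Cohomology of Groups*, III.10.3 [cite: Brown1982, III.10.3]; G. Shimura (1971) §8.3
[cite: Shimura1971, §8.3 (8.3.2)]; cell memo HOME/MEMO-es.md §25.9 (D); HOME/p1/NOTES-p1-g2.md (FINAL HANDOFF, extension plan).
-/

set_option autoImplicit false
set_option linter.dupNamespace false

open scoped MatrixGroups

open CongruenceSubgroup Matrix.SpecialLinearGroup Literature.NumberTheory.EllipticCurves.ModularForms
  Literature.NumberTheory.EllipticCurves.ModularForms.HidaCohomology Subgroup

namespace Summit.BirchSwinnertonDyer.BirchSwinnertonDyer.Theorems.ManinLocalTwoThree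

/-! ### The extension `Ψ` of `u` to `Γ₀(2^{j−1}L′)` with `Ψ(g) = 0`, and its `2`-shift invariance -/

section Extension

variable {p L' j : ℕ} {K : Type} [Field K] [CharP K p] [NeZero L'] (hL' : ¬ 2 ∣ L') (hj : 2 ≤ j)
  (S : Finset ℕ) (lam : ℕ → K) (u : cocycles 0 (L' * 2 ^ j) K)
  (hS : ∀ q : ℕ, q.Prime → q ∣ p * 2 * L' → q ∈ S) (hgen : IsHeckeGenEigenvector S lam u)
  (hNT : ∀ M : ℕ, ∃ r : ℕ, r.Prime ∧ r ∉ S ∧ r ≡ 1 [MOD 2 ^ M] ∧ lam r ≠ (r : K) + 1)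
  (hshift : degeneracyPullback 0 (L' * 2 ^ j) (L' * 2 ^ j * 2) 2 K dvd_rfl (u : Gamma0 (L' * 2 ^ j) → Fin 1 → K) =
    degeneracyPullback 0 (L' * 2 ^ j) (L' * 2 ^ j * 2) 1 K (by simp) (u : Gamma0 (L' * 2 ^ j) → Fin 1 → K))
  {U : SL(2, ℤ)} (hU : (U : Matrix (Fin 2) (Fin 2) ℤ) = !![1, 0; (L' : ℤ) * 2 ^ (j - 1), 1])

include hj hU

section NoChar

omit [CharP K p]
include hshift

/-- **`u(g²) = 0`** without any cusp hypothesis: `g² = U⁻(2^jL′)` is the `2`-shift of `g⁴ ∈ Γ₀(2^{j+1}L′)`, so shift-invariance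
gives `u(g²) = u(g⁴) = u(g²) + u(g²)`. [cite: Shimura1971, §8.3 (8.3.2)] -/
theorem apply_lowerUnip_sq_eq_zero :
    (u : Gamma0 (L' * 2 ^ j) → Fin 1 → K) ⟨U * U, lowerUnip_sq_mem_Gamma0 hj hU⟩ = 0 := by
  have hmem := lowerUnip_sq_mem_Gamma0 hj hU
  set g2 : Gamma0 (L' * 2 ^ j) := ⟨U * U, hmem⟩ with hg2
  have hUU : ((U * U : SL(2, ℤ)) : Matrix (Fin 2) (Fin 2) ℤ) = !![1, 0; 2 * ((L' : ℤ) * 2 ^ (j - 1)), 1] := by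
    rw [Matrix.SpecialLinearGroup.coe_mul, coe_lowerUnip_mul hU, hU]
    ext i k
    fin_cases i <;> fin_cases k <;> simp [two_mul]
  have h4 : (((g2 * g2 : Gamma0 (L' * 2 ^ j)) : SL(2, ℤ)) : Matrix (Fin 2) (Fin 2) ℤ) =
      !![1, 0; 2 * ((L' : ℤ) * 2 ^ (j - 1)) + 2 * ((L' : ℤ) * 2 ^ (j - 1)), 1] := by
    rw [Subgroup.coe_mul, Matrix.SpecialLinearGroup.coe_mul, hg2]
    show ((U * U : SL(2, ℤ)) : Matrix (Fin 2) (Fin 2) ℤ) * ((U * U : SL(2, ℤ)) : Matrix (Fin 2) (Fin 2) ℤ) = _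
    rw [hUU]
    ext i k
    fin_cases i <;> fin_cases k <;> simp [Matrix.mul_apply, Fin.sum_univ_two]
  obtain ⟨a00, a01, a10, a11⟩ := sl_entries_of_coe_eq (X := ((g2 : Gamma0 (L' * 2 ^ j)) : SL(2, ℤ))) hUU
  obtain ⟨b00, b01, b10, b11⟩ := sl_entries_of_coe_eq h4
  -- `g²` is the `2`-shift of `g⁴`
  have hR : ((g2 : Gamma0 (L' * 2 ^ j)) : SL(2, ℤ)) 0 0 = ((g2 * g2 : Gamma0 (L' * 2 ^ j)) : SL(2, ℤ)) 0 0 ∧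
      ((g2 : Gamma0 (L' * 2 ^ j)) : SL(2, ℤ)) 0 1 = (2 : ℤ) * ((g2 * g2 : Gamma0 (L' * 2 ^ j)) : SL(2, ℤ)) 0 1 ∧
      (2 : ℤ) * ((g2 : Gamma0 (L' * 2 ^ j)) : SL(2, ℤ)) 1 0 = ((g2 * g2 : Gamma0 (L' * 2 ^ j)) : SL(2, ℤ)) 1 0 ∧
      ((g2 : Gamma0 (L' * 2 ^ j)) : SL(2, ℤ)) 1 1 = ((g2 * g2 : Gamma0 (L' * 2 ^ j)) : SL(2, ℤ)) 1 1 :=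
    ⟨by linear_combination a00 - b00, by linear_combination a01 - 2 * b01, by linear_combination 2 * a10 - b10,
      by linear_combination a11 - b11⟩
  have key := apply_eq_of_shiftInvariant_d hshift (g2 * g2) g2 (by exact_mod_cast hR)
  rw [cocycle_zero_mul u.2] at key
  -- `a = a + a ⟹ a = 0`
  have h0 : (u : Gamma0 (L' * 2 ^ j) → Fin 1 → K) g2 + 0 = (u : Gamma0 (L' * 2 ^ j) → Fin 1 → K) g2 +
      (u : Gamma0 (L' * 2 ^ j) → Fin 1 → K) g2 := by rw [add_zero]; exact key
  exact (add_left_cancel h0).symm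

omit hshift in
/-- **Uniqueness source**: any additive `2`-shift-invariant `Ψ′` on `Γ₀(2^{j−1}L′)` has `Ψ′(g) = Ψ′(g²)`, because `g = U⁻(x)`
is the `2`-shift of `g² = U⁻(2x) ∈ Γ₀(2·2^{j−1}L′)`. [cite: Shimura1971, §8.3 (8.3.2)] -/
theorem descentTwo_apply_lowerUnip_eq {Ψ : Gamma0 (L' * 2 ^ (j - 1)) → Fin 1 → K}
    (hΨsh : degeneracyPullback 0 (L' * 2 ^ (j - 1)) (L' * 2 ^ (j - 1) * 2) 2 K dvd_rfl Ψ =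
      degeneracyPullback 0 (L' * 2 ^ (j - 1)) (L' * 2 ^ (j - 1) * 2) 1 K (by simp) Ψ) :
    Ψ ⟨U, lowerUnip_mem_Gamma0_half hU⟩ =
      Ψ ⟨U * U, Gamma0_level_le L' j (by omega) (lowerUnip_sq_mem_Gamma0 hj hU)⟩ := by
  have hUU : ((U * U : SL(2, ℤ)) : Matrix (Fin 2) (Fin 2) ℤ) = !![1, 0; 2 * ((L' : ℤ) * 2 ^ (j - 1)), 1] := by
    rw [Matrix.SpecialLinearGroup.coe_mul, coe_lowerUnip_mul hU, hU]
    ext i k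
    fin_cases i <;> fin_cases k <;> simp [two_mul]
  obtain ⟨a00, a01, a10, a11⟩ := sl_entries_of_coe_eq hU
  obtain ⟨b00, b01, b10, b11⟩ := sl_entries_of_coe_eq hUU
  have hR : (U : SL(2, ℤ)) 0 0 = (U * U : SL(2, ℤ)) 0 0 ∧ (U : SL(2, ℤ)) 0 1 = (2 : ℤ) * (U * U : SL(2, ℤ)) 0 1 ∧
      (2 : ℤ) * (U : SL(2, ℤ)) 1 0 = (U * U : SL(2, ℤ)) 1 0 ∧ (U : SL(2, ℤ)) 1 1 = (U * U : SL(2, ℤ)) 1 1 :=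
    ⟨by linear_combination a00 - b00, by linear_combination a01 - 2 * b01, by linear_combination 2 * a10 - b10,
      by linear_combination a11 - b11⟩
  exact apply_eq_of_shiftInvariant_d hΨsh ⟨U * U, _⟩ ⟨U, _⟩ (by exact_mod_cast hR)

end NoChar

include hL' hS hgen hNT hshift

/-- **The extension.**  There is an additive `Ψ : Γ₀(2^{j−1}L′) → K` with `Ψ(g) = 0` restricting to `u` on `Γ₀(2^jL′)`:
es's `extTwo` with `y := 0` (`u(g²) = 0`), the `g`-stability of `u` being `adLowerUnip_invariant`. [cite: Brown1982, III.10.3] -/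
theorem exists_descentTwo_extension :
    ∃ Ψ : Gamma0 (L' * 2 ^ (j - 1)) → K,
      (∀ a b : Gamma0 (L' * 2 ^ (j - 1)), Ψ (a * b) = Ψ a + Ψ b) ∧
      Ψ ⟨U, lowerUnip_mem_Gamma0_half hU⟩ = 0 ∧
      ∀ γ : Gamma0 (L' * 2 ^ j),
        Ψ ⟨(γ : SL(2, ℤ)), Gamma0_level_le L' j (by omega) γ.2⟩ = (u : Gamma0 (L' * 2 ^ j) → Fin 1 → K) γ 0 := by
  classical
  set M : Subgroup (Gamma0 (L' * 2 ^ (j - 1))) := (Gamma0 (L' * 2 ^ j)).subgroupOf (Gamma0 (L' * 2 ^ (j - 1))) with hM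
  have memM : ∀ {a : Gamma0 (L' * 2 ^ (j - 1))}, a ∈ M ↔ (a : SL(2, ℤ)) ∈ Gamma0 (L' * 2 ^ j) := mem_subgroupOf
  have hidx : M.index = 2 := index_gamma0_level_two hj hU
  set g : Gamma0 (L' * 2 ^ (j - 1)) := ⟨U, lowerUnip_mem_Gamma0_half hU⟩ with hg
  have hgM : g ∉ M := fun h ↦ lowerUnip_not_mem_Gamma0 hj hU (memM.mp h)
  let ψ : M → K := fun a ↦ (u : Gamma0 (L' * 2 ^ j) → Fin 1 → K) ⟨((a : Gamma0 (L' * 2 ^ (j - 1))) : SL(2, ℤ)), memM.mp a.2⟩ 0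
  have hψ : ∀ a : M, ψ a =
      (u : Gamma0 (L' * 2 ^ j) → Fin 1 → K) ⟨((a : Gamma0 (L' * 2 ^ (j - 1))) : SL(2, ℤ)), memM.mp a.2⟩ 0 := fun a ↦ rfl
  have hmul : ∀ a b : M, ψ (a * b) = ψ a + ψ b := by
    intro a b
    rw [hψ, hψ, hψ]
    have e : (⟨(((a * b : M) : Gamma0 (L' * 2 ^ (j - 1))) : SL(2, ℤ)), memM.mp (a * b).2⟩ : Gamma0 (L' * 2 ^ j)) =
        ⟨((a : Gamma0 (L' * 2 ^ (j - 1))) : SL(2, ℤ)), memM.mp a.2⟩ *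
          ⟨((b : Gamma0 (L' * 2 ^ (j - 1))) : SL(2, ℤ)), memM.mp b.2⟩ := rfl
    rw [e, cocycle_zero_mul u.2, Pi.add_apply]
  have hstab : ∀ (a : M) (ha : g⁻¹ * (a : Gamma0 (L' * 2 ^ (j - 1))) * g ∈ M),
      ψ ⟨g⁻¹ * (a : Gamma0 (L' * 2 ^ (j - 1))) * g, ha⟩ = ψ a := by
    intro a ha
    rw [hψ, hψ]
    have ha' : U⁻¹ * ((a : Gamma0 (L' * 2 ^ (j - 1))) : SL(2, ℤ)) * U ∈ Gamma0 (L' * 2 ^ j) := memM.mp ha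
    have key := adLowerUnip_invariant hL' hj S lam u hS hgen hNT hshift hU ⟨_, ha'⟩
    have e1 : (⟨U * ((⟨_, ha'⟩ : Gamma0 (L' * 2 ^ j)) : SL(2, ℤ)) * U⁻¹,
        (mem_Gamma0_iff_lowerUnip_conj hU (level_eq_two_mul L' j (by omega)) (two_dvd_half_level L' j hj) _).mp
          (⟨_, ha'⟩ : Gamma0 (L' * 2 ^ j)).2⟩ : Gamma0 (L' * 2 ^ j)) =
        ⟨((a : Gamma0 (L' * 2 ^ (j - 1))) : SL(2, ℤ)), memM.mp a.2⟩ := by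
      apply Subtype.ext
      show U * (U⁻¹ * ((a : Gamma0 (L' * 2 ^ (j - 1))) : SL(2, ℤ)) * U) * U⁻¹ = _
      group
    rw [e1] at key
    have e2 : (⟨(((⟨g⁻¹ * (a : Gamma0 (L' * 2 ^ (j - 1))) * g, ha⟩ : M) : Gamma0 (L' * 2 ^ (j - 1))) : SL(2, ℤ)),
        memM.mp ha⟩ : Gamma0 (L' * 2 ^ j)) = ⟨_, ha'⟩ := rfl
    rw [e2, ← key]
  have hy : (0 : K) + 0 = ψ ⟨g * g, Subgroup.mul_self_mem_of_index_two hidx g⟩ := by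
    rw [add_zero, hψ]
    have e : (⟨(((⟨g * g, Subgroup.mul_self_mem_of_index_two hidx g⟩ : M) : Gamma0 (L' * 2 ^ (j - 1))) : SL(2, ℤ)),
        memM.mp (Subgroup.mul_self_mem_of_index_two hidx g)⟩ : Gamma0 (L' * 2 ^ j)) =
        ⟨U * U, lowerUnip_sq_mem_Gamma0 hj hU⟩ := rfl
    rw [e, apply_lowerUnip_sq_eq_zero hj u hshift hU, Pi.zero_apply]
  obtain ⟨Ψ, ⟨hΨmul, hΨg, hΨM⟩, -⟩ := extTwo (Gamma0 (L' * 2 ^ (j - 1))) M K g hidx hgM ψ hmul hstab 0 hy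
  refine ⟨Ψ, hΨmul, hΨg, fun γ ↦ ?_⟩
  have hγM : (⟨(γ : SL(2, ℤ)), Gamma0_level_le L' j (by omega) γ.2⟩ : Gamma0 (L' * 2 ^ (j - 1))) ∈ M := memM.mpr γ.2
  rw [hΨM ⟨_, hγM⟩, hψ]

omit hL' hS hgen hNT

/-- **`2`-shift invariance of the extension** (MEMO-es §25.9 (D)): an additive `Ψ` on `Γ₀(2^{j−1}L′)` with `Ψ(g) = 0` and
`Ψ|Γ₀(2^jL′) = u` satisfies `π₂^* Ψ = π₁^* Ψ` on `Γ₀(2^jL′)`. [cite: Shimura1971, §8.3 (8.3.2)] -/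
theorem descentTwo_shiftInvariant {Ψ : Gamma0 (L' * 2 ^ (j - 1)) → Fin 1 → K}
    (hΨmul : ∀ a b : Gamma0 (L' * 2 ^ (j - 1)), Ψ (a * b) = Ψ a + Ψ b)
    (hΨg : Ψ ⟨U, lowerUnip_mem_Gamma0_half hU⟩ = 0)
    (hΨres : ∀ γ : Gamma0 (L' * 2 ^ j), Ψ ⟨(γ : SL(2, ℤ)), Gamma0_level_le L' j (by omega) γ.2⟩ =
      (u : Gamma0 (L' * 2 ^ j) → Fin 1 → K) γ) :
    degeneracyPullback 0 (L' * 2 ^ (j - 1)) (L' * 2 ^ (j - 1) * 2) 2 K dvd_rfl Ψ =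
      degeneracyPullback 0 (L' * 2 ^ (j - 1)) (L' * 2 ^ (j - 1) * 2) 1 K (by simp) Ψ := by
  have hj1 : 1 ≤ j := by omega
  have hN := level_eq_two_mul L' j hj1
  have hx2 := two_dvd_half_level L' j hj
  have hlev : L' * 2 ^ (j - 1) * 2 = L' * 2 ^ j := by
    obtain ⟨i, rfl⟩ := Nat.exists_eq_add_of_le hj1
    rw [Nat.add_sub_cancel_left]; ring
  have hu2 := apply_lowerUnip_sq_eq_zero hj u hshift hU
  funext δ i
  have hi : i = 0 := Subsingleton.elim (α := Fin 1) i 0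
  subst hi
  rw [degeneracyPullback_zero_apply, degeneracyPullback_zero_apply]
  -- `δ` as an element of `Γ₀(2^jL′)`
  have hδN : (δ : SL(2, ℤ)) ∈ Gamma0 (L' * 2 ^ j) := hlev ▸ δ.2
  set δN : Gamma0 (L' * 2 ^ j) := ⟨(δ : SL(2, ℤ)), hδN⟩ with hδN'
  -- the `d = 1` side is `Ψ δ = u δ`
  have e1 : Gamma0.degeneracyConj (L' * 2 ^ (j - 1)) (L' * 2 ^ (j - 1) * 2) 1 (by simp) δ =
      ⟨(δ : SL(2, ℤ)), Gamma0_level_le L' j hj1 hδN⟩ := Subtype.ext (Gamma0.coe_degeneracyConj_one _ δ)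
  rw [e1, hΨres δN]
  -- the shifted element `δ₂ = A δ A⁻¹`
  set δ₂ := Gamma0.degeneracyConj (L' * 2 ^ (j - 1)) (L' * 2 ^ (j - 1) * 2) 2 dvd_rfl δ with hδ₂
  have h00 : (δ₂ : SL(2, ℤ)) 0 0 = (δ : SL(2, ℤ)) 0 0 := by rw [hδ₂, Gamma0.degeneracyConj_apply]; rfl
  have h01 : (δ₂ : SL(2, ℤ)) 0 1 = 2 * (δ : SL(2, ℤ)) 0 1 := by
    rw [hδ₂, Gamma0.degeneracyConj_apply, Gamma0.degeneracyConjElt_apply_zero_one]; push_cast; rfl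
  have h10' : (δ₂ : SL(2, ℤ)) 1 0 = (δ : SL(2, ℤ)) 1 0 / 2 := by
    rw [hδ₂, Gamma0.degeneracyConj_apply, Gamma0.degeneracyConjElt_apply_one_zero]; push_cast; rfl
  have h11 : (δ₂ : SL(2, ℤ)) 1 1 = (δ : SL(2, ℤ)) 1 1 := by rw [hδ₂, Gamma0.degeneracyConj_apply]; rfl
  -- `c_δ = 2x·m`
  obtain ⟨m, hm⟩ : 2 * ((L' : ℤ) * 2 ^ (j - 1)) ∣ (δ : SL(2, ℤ)) 1 0 := by
    have h := natCast_dvd_gamma0_apply_one_zero δN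
    rw [hN] at h
    exact h
  have h10 : (δ₂ : SL(2, ℤ)) 1 0 = ((L' : ℤ) * 2 ^ (j - 1)) * m := by
    rw [h10', hm, mul_assoc, Int.mul_ediv_cancel_left _ two_ne_zero]
  have h10'' : 2 * (δ₂ : SL(2, ℤ)) 1 0 = (δ : SL(2, ℤ)) 1 0 := by rw [h10, hm]; ring
  rcases Int.even_or_odd m with ⟨k, hk⟩ | hmodd
  · -- Case `4x ∣ c_δ`: `δ₂ ∈ Γ₀(2^jL′)` and it is `u`'s shift-invariance
    have hδ₂N : (δ₂ : SL(2, ℤ)) ∈ Gamma0 (L' * 2 ^ j) := by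
      apply mem_Gamma0_of_dvd_apply_one_zero
      rw [hN, h10, hk]
      exact ⟨k, by ring⟩
    have e2 : δ₂ = ⟨(δ₂ : SL(2, ℤ)), Gamma0_level_le L' j hj1 hδ₂N⟩ := Subtype.ext rfl
    rw [e2, hΨres ⟨_, hδ₂N⟩]
    exact congrFun
      (apply_eq_of_shiftInvariant_d hshift δN ⟨_, hδ₂N⟩ ⟨h00, by exact_mod_cast h01, by exact_mod_cast h10'', h11⟩) 0
  · -- Case `c_δ = 2x·m`, `m` odd: `δ₂ = g · (g⁻¹ δ₂)`, `g⁻¹δ₂ ∈ Γ₀(2^jL′)` is the `2`-shift of `g⁻² δ ∈ Γ₀(2^{j+1}L′)`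
    have hc2 : (2 : ℤ) ∣ (δ : SL(2, ℤ)) 1 0 := by rw [hm]; exact ⟨(L' : ℤ) * 2 ^ (j - 1) * m, by ring⟩
    obtain ⟨ha, -⟩ := odd_of_det_of_even (det_entries (δ : SL(2, ℤ))) hc2
    obtain ⟨k, hk⟩ := Odd.sub_odd hmodd ha
    -- `g⁻¹ δ₂ ∈ Γ₀(2^jL′)`
    have hginv : U⁻¹ * (δ₂ : SL(2, ℤ)) ∈ Gamma0 (L' * 2 ^ j) := by
      apply mem_Gamma0_of_dvd_apply_one_zero
      show ((L' * 2 ^ j : ℕ) : ℤ) ∣ (((U⁻¹ : SL(2, ℤ)) : Matrix (Fin 2) (Fin 2) ℤ) * ((δ₂ : SL(2, ℤ)) : Matrix (Fin 2) (Fin 2) ℤ)) 1 0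
      rw [coe_lowerUnip_inv_mul hU, hN]
      simp only [Matrix.of_apply, Matrix.cons_val', Matrix.cons_val_zero, Matrix.cons_val_one, Matrix.empty_val',
        Matrix.cons_val_fin_one]
      refine ⟨k, ?_⟩
      have e00 : ((δ₂ : SL(2, ℤ)) : Matrix (Fin 2) (Fin 2) ℤ) 0 0 = (δ : SL(2, ℤ)) 0 0 := h00
      have e10 : ((δ₂ : SL(2, ℤ)) : Matrix (Fin 2) (Fin 2) ℤ) 1 0 = ((L' : ℤ) * 2 ^ (j - 1)) * m := h10
      rw [e00, e10]
      have hk' : m - (δ : SL(2, ℤ)) 0 0 = k + k := hk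
      linear_combination ((L' : ℤ) * 2 ^ (j - 1)) * hk'
    -- `Ψ δ₂ = Ψ g + Ψ (g⁻¹ δ₂) = u (g⁻¹ δ₂)`
    have esplit : δ₂ = (⟨U, lowerUnip_mem_Gamma0_half hU⟩ : Gamma0 (L' * 2 ^ (j - 1))) *
        ⟨U⁻¹ * (δ₂ : SL(2, ℤ)), Gamma0_level_le L' j hj1 hginv⟩ := by
      apply Subtype.ext
      show (δ₂ : SL(2, ℤ)) = U * (U⁻¹ * (δ₂ : SL(2, ℤ)))
      rw [mul_inv_cancel_left]
    rw [esplit, hΨmul, hΨg, zero_add, hΨres ⟨_, hginv⟩]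
    -- `δ₃ := g⁻² δ ∈ Γ₀(2^jL′)` (indeed in `Γ₀(2^{j+1}L′)`), and `g⁻¹ δ₂` is its `2`-shift
    have hδ₃ : (U * U)⁻¹ * (δ : SL(2, ℤ)) ∈ Gamma0 (L' * 2 ^ j) :=
      Subgroup.mul_mem _ (Subgroup.inv_mem _ (lowerUnip_sq_mem_Gamma0 hj hU)) hδN
    have hUU : ((U * U : SL(2, ℤ)) : Matrix (Fin 2) (Fin 2) ℤ) = !![1, 0; 2 * ((L' : ℤ) * 2 ^ (j - 1)), 1] := by
      rw [Matrix.SpecialLinearGroup.coe_mul, coe_lowerUnip_mul hU, hU]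
      ext i k
      fin_cases i <;> fin_cases k <;> simp [two_mul]
    -- entries of `δ₃ = g⁻² δ` and of `g⁻¹ δ₂`
    have hδ₃coe : (((U * U)⁻¹ * (δ : SL(2, ℤ)) : SL(2, ℤ)) : Matrix (Fin 2) (Fin 2) ℤ) =
        ((U * U)⁻¹ : SL(2, ℤ)) * ((δ : SL(2, ℤ)) : Matrix (Fin 2) (Fin 2) ℤ) := Matrix.SpecialLinearGroup.coe_mul _ _
    have hinvUU : (((U * U)⁻¹ : SL(2, ℤ)) : Matrix (Fin 2) (Fin 2) ℤ) = !![1, 0; -(2 * ((L' : ℤ) * 2 ^ (j - 1))), 1] := by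
      rw [Matrix.SpecialLinearGroup.coe_inv, hUU, Matrix.adjugate_fin_two]
      ext i k
      fin_cases i <;> fin_cases k <;> simp
    have f3_00 : (((U * U)⁻¹ * (δ : SL(2, ℤ)) : SL(2, ℤ))) 0 0 = (δ : SL(2, ℤ)) 0 0 := by
      show ((((U * U)⁻¹ * (δ : SL(2, ℤ)) : SL(2, ℤ))) : Matrix (Fin 2) (Fin 2) ℤ) 0 0 = _
      rw [hδ₃coe, hinvUU]; simp [Matrix.mul_apply, Fin.sum_univ_two]
    have f3_01 : (((U * U)⁻¹ * (δ : SL(2, ℤ)) : SL(2, ℤ))) 0 1 = (δ : SL(2, ℤ)) 0 1 := by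
      show ((((U * U)⁻¹ * (δ : SL(2, ℤ)) : SL(2, ℤ))) : Matrix (Fin 2) (Fin 2) ℤ) 0 1 = _
      rw [hδ₃coe, hinvUU]; simp [Matrix.mul_apply, Fin.sum_univ_two]
    have f3_10 : (((U * U)⁻¹ * (δ : SL(2, ℤ)) : SL(2, ℤ))) 1 0 =
        -(2 * ((L' : ℤ) * 2 ^ (j - 1))) * (δ : SL(2, ℤ)) 0 0 + (δ : SL(2, ℤ)) 1 0 := by
      show ((((U * U)⁻¹ * (δ : SL(2, ℤ)) : SL(2, ℤ))) : Matrix (Fin 2) (Fin 2) ℤ) 1 0 = _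
      rw [hδ₃coe, hinvUU]; simp [Matrix.mul_apply, Fin.sum_univ_two]
    have f3_11 : (((U * U)⁻¹ * (δ : SL(2, ℤ)) : SL(2, ℤ))) 1 1 =
        -(2 * ((L' : ℤ) * 2 ^ (j - 1))) * (δ : SL(2, ℤ)) 0 1 + (δ : SL(2, ℤ)) 1 1 := by
      show ((((U * U)⁻¹ * (δ : SL(2, ℤ)) : SL(2, ℤ))) : Matrix (Fin 2) (Fin 2) ℤ) 1 1 = _
      rw [hδ₃coe, hinvUU]; simp [Matrix.mul_apply, Fin.sum_univ_two]
    have hgδ₂coe : ((U⁻¹ * (δ₂ : SL(2, ℤ)) : SL(2, ℤ)) : Matrix (Fin 2) (Fin 2) ℤ) =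
        !![(δ₂ : SL(2, ℤ)) 0 0, (δ₂ : SL(2, ℤ)) 0 1;
          -((L' : ℤ) * 2 ^ (j - 1)) * (δ₂ : SL(2, ℤ)) 0 0 + (δ₂ : SL(2, ℤ)) 1 0,
          -((L' : ℤ) * 2 ^ (j - 1)) * (δ₂ : SL(2, ℤ)) 0 1 + (δ₂ : SL(2, ℤ)) 1 1] := by
      rw [Matrix.SpecialLinearGroup.coe_mul, coe_lowerUnip_inv_mul hU]
    obtain ⟨f2_00, f2_01, f2_10, f2_11⟩ := sl_entries_of_coe_eq hgδ₂coe
    have hm' : (δ : SL(2, ℤ)) 1 0 = 2 * ((L' : ℤ) * 2 ^ (j - 1)) * m := hm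
    have hR : ((U⁻¹ * (δ₂ : SL(2, ℤ)) : SL(2, ℤ))) 0 0 = (((U * U)⁻¹ * (δ : SL(2, ℤ)) : SL(2, ℤ))) 0 0 ∧
        ((U⁻¹ * (δ₂ : SL(2, ℤ)) : SL(2, ℤ))) 0 1 = (2 : ℤ) * (((U * U)⁻¹ * (δ : SL(2, ℤ)) : SL(2, ℤ))) 0 1 ∧
        (2 : ℤ) * ((U⁻¹ * (δ₂ : SL(2, ℤ)) : SL(2, ℤ))) 1 0 = (((U * U)⁻¹ * (δ : SL(2, ℤ)) : SL(2, ℤ))) 1 0 ∧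
        ((U⁻¹ * (δ₂ : SL(2, ℤ)) : SL(2, ℤ))) 1 1 = (((U * U)⁻¹ * (δ : SL(2, ℤ)) : SL(2, ℤ))) 1 1 :=
      ⟨by linear_combination f2_00 + h00 - f3_00, by linear_combination f2_01 + h01 - 2 * f3_01,
        by linear_combination 2 * f2_10 - f3_10 - 2 * ((L' : ℤ) * 2 ^ (j - 1)) * h00 + 2 * h10 - hm',
        by linear_combination f2_11 - f3_11 - ((L' : ℤ) * 2 ^ (j - 1)) * h01 + h11⟩
    have key := apply_eq_of_shiftInvariant_d hshift ⟨_, hδ₃⟩ ⟨_, hginv⟩ (by exact_mod_cast hR)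
    rw [key]
    have e3 : (⟨_, hδ₃⟩ : Gamma0 (L' * 2 ^ j)) = (⟨U * U, lowerUnip_sq_mem_Gamma0 hj hU⟩ : Gamma0 (L' * 2 ^ j))⁻¹ * δN := rfl
    rw [e3, cocycle_zero_mul u.2, cocycle_zero_inv u.2, hu2, neg_zero, zero_add]

end Extension

end Summit.BirchSwinnertonDyer.BirchSwinnertonDyer.Theorems.ManinLocalTwoThree
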